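import Summits.BirchSwinnertonDyer.BirchSwinnertonDyer.Theses.PrintX11a
import Summits.BirchSwinnertonDyer.Rank1Residual.X11a.ChaRecords1
import HarnessLib

/-!
# Route `PrintX11a` (cell `bsd-print-x11a`, seat p3), crux 3 `X11aNonSurjEulerHalf` (item stmt-BirchSwinnertonDyer-20406):
# the analytic residual is needed only on the HARD sub-locus — split at `p`, or `p ∣ L(E,1)/Ω_E`
# (`--supports stmt-BirchSwinnertonDyer-20406`)

Refinement of `Theorems/PrintX11aNonSurjEulerHalfOfMu.lean` §4/§6 (p539522): there the crux follows from thirteen named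
facts plus the ANALYTIC `μ = 0` certificate at EVERY non-surjective X11a pair, and §6 observed that at a NON-split pair
with `ord_p(L(E,1)/Ω_E) = 0` the certificate is automatic (the constant term of the Néron-normalised Mazur–Tate–Teitelbaum
function is `2·L(E,1)/Ω_E`). This file states the consequence at CLASS level:

* **`x11aNonSurjEulerHalf_of_katoFacts_of_muAn_offUnitValue`** — the crux BY NAME ⟸ the thirteen facts + Greenberg–Stevens +
  the analytic certificate ONLY at the non-surjective X11a pairs `(W,p)` that are SPLIT multiplicative at `p` or have
  `ord_p(L(E,1)/Ω_E) ≠ 0` (equivalently, since `#Ш_an` is a `p`-unit or not and `p ∤ #E(ℚ)_tors` at irreducible `E[p]`: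
  `p ∣ #Ш_an·∏c_ℓ`). On the census of the cell (ty3, `N < 5·10⁵` at `5`, `N < 2·10⁴` at `3`) this hard sub-locus is
  37 of the 68 known pairs (28 split — where moreover the `T¹`-coefficient is never a unit, HOME/P3-EXCEPTIONAL-ZERO-ROAD.md §5 —
  and 9 non-split with `p ∣ ∏c_ℓ`); the other 31 need nothing beyond the facts.

The rational `L(E,1)/Ω_E` is produced from a modular parametrisation (`hpar`) as `ϖ·[0]⁺_f`, so the locus condition is
stated intrinsically («for every rational `t` with `L(E,1)/Ω_E = t`, `ord_p t ≠ 0`»). Tool: the class-free unit-value door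
`X11a.ChaRecords.mub_of_unitValue_nonsplit` (route-file-free, `X11a/ChaRecords1.lean`, p544896).

HONEST FRAMING. ONE theorem (no definition, no named fact, no `sorry`); CONDITIONAL on the thirteen named facts (three
construction facts, flags `Kato-17.11-at-{nonsplit,split}-mult`, `Kato-p280-image-at-mult`) and the displayed certificate
shape; item 20406 does NOT close; BSD is not advanced; no census word moves. «beyond-print theorem: NO».

References: [MazurTateTeitelbaum1986] §I.10; [Wuthrich2014] Cor. 18 (p. 398); [Kato2004Asterisque] §17.13 (pp. 279–280);
[SteinWuthrich2013] Thm. 6.1; [GreenbergLNM1716] Conj. 1.11; tree p539522, p544896.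
-/

set_option autoImplicit false
set_option linter.dupNamespace false

noncomputable section

open scoped Classical NumberField MatrixGroups ModularForm

open CongruenceSubgroup WeierstrassCurve Field
  Literature.NumberTheory.EllipticCurves
  Literature.NumberTheory.EllipticCurves.ModularForms
  Literature.NumberTheory.EllipticCurves.Rank1Residual
  Literature.NumberTheory.EllipticCurves.Rank1Residual.Typed
  Literature.NumberTheory.EllipticCurves.Wuthrich2014
  Literature.NumberTheory.EllipticCurves.SteinWuthrich2013
  Literature.NumberTheory.EllipticCurves.Greenberg1999
  Literature.NumberTheory.EllipticCurves.Kato2004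
  Summit.BirchSwinnertonDyer.Rank1Residual
  Summit.BirchSwinnertonDyer.Rank1Residual.X11b

namespace Summit.BirchSwinnertonDyer.BirchSwinnertonDyer.Theorems

/-- **Crux 3 `X11aNonSurjEulerHalf` ⟸ thirteen named facts + Greenberg–Stevens + the analytic `μ = 0` certificate on
the HARD sub-locus only** (non-surjective X11a pairs that are split multiplicative at `p`, or whose Néron-normalised
special value `L(E,1)/Ω_E` has `ord_p ≠ 0`). Off that sub-locus (non-split ∧ `ord_p(L(E,1)/Ω_E) = 0`) the certificate is
the constant term `2·L(E,1)/Ω_E` itself (`X11a.ChaRecords.mub_of_unitValue_nonsplit`); on it, the hypothesis `hHard`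
supplies a unit coefficient and the chain is `X11b.multDivisibilityAt_of_katoFacts_of_muAn` ∘ the rank-`0` engine. The
rational `t = L(E,1)/Ω_E` exists by `hpar` (`t = ϖ·[0]⁺_f`) and is unique, so the locus clause of `hHard` is intrinsic.
CONDITIONAL; closes nothing by itself. [cite: MazurTateTeitelbaum1986, §I.10 and §I.14]
[cite: Wuthrich2014, Cor. 18 (p. 398)] [cite: Kato2004Asterisque, Thm. 12.6 (p. 222) and §17.13 (pp. 279–280)]
[cite: SteinWuthrich2013, Thm. 6.1 (p. 20)] [cite: GreenbergLNM1716, §1 Conj. 1.11 (shape)] -/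
theorem x11aNonSurjEulerHalf_of_katoFacts_of_muAn_offUnitValue
    (hJs : thm61_splitMultiplicative) (hJn : thm61_nonsplitMultiplicative)
    (hGZK : rank_eq_analyticRank_of_analyticRank_le_one) (hmod : hasEntireLFunction_rat)
    (hpar : nonempty_modularParametrizationData)
    (hGS : ∀ (W : WeierstrassCurve ℚ) [W.IsElliptic] [W.IsGloballyMinimal] (p : ℕ) [Fact p.Prime],
      greenberg_stevens (W := W) (p := p))
    (hne : Kato2004.nonempty_iwasawaH1Data) (h12 : Kato2004.thm12_4)
    (hns : Kato2004.exists_multDivisibilityInputs_nonsplit)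
    (hsp : Kato2004.exists_multDivisibilityInputs_split)
    (h15 : thm15_isTorsion_multiplicative_rat)
    (h18 : Wuthrich2014.corollary18_padicLFunction_mem_iwasawaAlgebra_multiplicative)
    (hfine : Kato2004.exists_multDivisibilityInputs_fine)
    (hHard : ∀ (W : WeierstrassCurve ℚ) [W.IsElliptic] [W.IsGloballyMinimal] (p : ℕ) [Fact p.Prime],
      ClassX11a W p → ¬ Surj W p →
      (W.HasSplitMultiplicativeReductionAtPrime p ∨
        ∀ t : ℚ, W.entireLFunction 1 / (W.realPeriodRat : ℂ) = (t : ℂ) → padicValRat p t ≠ 0) →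
      ∀ {N : ℕ} [NeZero N] (f : CuspForm (Gamma0 N) 2), IsNewformOf W f →
      ∀ (ϖ : ℚ), (ϖ : ℝ) * W.realPeriodRat = plusPeriod f →
      ∀ (a : ℚ_[p]) (L : PowerSeries ℚ_[p]),
        (W.HasSplitMultiplicativeReductionAtPrime p → a = 1) →
        (¬ W.HasSplitMultiplicativeReductionAtPrime p → a = -1) →
        IsMultPAdicLFunctionOf f p a L →
        ∃ n : ℕ, ‖PowerSeries.coeff n (PowerSeries.C ((ϖ : ℚ) : ℚ_[p]) * L)‖ = 1) :
    Summit.BirchSwinnertonDyer.BirchSwinnertonDyer.Theses.PrintX11a.X11aNonSurjEulerHalf := by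
  intro W _ _ p _ hX hnsj
  have hp2 : p ≠ 2 := hX.ne_two
  by_cases hsplit : W.HasSplitMultiplicativeReductionAtPrime p
  · exact missingUpperBoundAt_of_classX11a_of_multDivisibilityAt hJs hJn hGZK hmod hpar W p (hGS W p) hX
      (multDivisibilityAt_of_katoFacts_of_muAn hne h12 hns hsp h15 h18 hfine W p hp2 hX.mult hX.irr hnsj
        (hHard W p hX hnsj (Or.inl hsplit)))
  · -- the rational `t = L(E,1)/Ω_E` from a modular parametrisation
    haveI : NeZero (W.conductorNorm ℤ) := ⟨(W.conductorNorm_pos_holds).ne'⟩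
    obtain ⟨Dm⟩ := hpar W
    obtain ⟨ϖ, -, hϖ, -⟩ := Dm.exists_rat_mul_realPeriodRat_eq_plusPeriod
    have hΩpos : 0 < W.realPeriodRat := W.realPeriodRat_pos_holds
    have hLval : W.entireLFunction 1 = ((((ratPlusSymbol Dm.f 0 : ℚ) : ℝ) * plusPeriod Dm.f : ℝ) : ℂ) :=
      Dm.isNewformOf.entireLFunction_one_eq
    set t : ℚ := ϖ * ratPlusSymbol Dm.f 0 with ht_def
    have ht : W.entireLFunction 1 / (W.realPeriodRat : ℂ) = ((t : ℚ) : ℂ) := by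
      rw [hLval, ← hϖ, div_eq_iff (Complex.ofReal_ne_zero.mpr hΩpos.ne'), ht_def]
      push_cast
      ring
    by_cases hunit : padicValRat p t = 0
    · exact X11a.ChaRecords.mub_of_unitValue_nonsplit hJs hJn hGZK hmod hpar hne h12 hns hsp h15 h18 hfine W p
        (hGS W p) hp2 hX.analyticRank_eq_zero hX.mult hX.irr hnsj hsplit t ht hunit
    · have hloc : ∀ t' : ℚ, W.entireLFunction 1 / (W.realPeriodRat : ℂ) = (t' : ℂ) → padicValRat p t' ≠ 0 := by
        intro t' ht'
        have htt : t' = t := by exact_mod_cast ht'.symm.trans ht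
        rw [htt]
        exact hunit
      exact missingUpperBoundAt_of_classX11a_of_multDivisibilityAt hJs hJn hGZK hmod hpar W p (hGS W p) hX
        (multDivisibilityAt_of_katoFacts_of_muAn hne h12 hns hsp h15 h18 hfine W p hp2 hX.mult hX.irr hnsj
          (hHard W p hX hnsj (Or.inr hloc)))

end Summit.BirchSwinnertonDyer.BirchSwinnertonDyer.Theorems

end
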